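import Summits.CriticalPhenomena.PercolationContinuityZ3.Theorems.Transplant.SkelPhiFaceRouteHrouteX6
import Summits.CriticalPhenomena.PercolationContinuityZ3.Theorems.Transplant.SkelPhiFaceRouteHrouteY6
import Summits.CriticalPhenomena.PercolationContinuityZ3.Theorems.Transplant.SkelPhiFaceRunNb2
import Summits.CriticalPhenomena.PercolationContinuityZ3.Theorems.Transplant.SkelPhiFaceExitTable
import HarnessLib

/-!
# N1 ({±1} node), (F) column, part F5-6 (hp-8 g35): **THE `hkits` HYPOTHESIS OF `faceOblRM_fineNb2` FROM THE KIT INPUTS AND THE PER-CENTRE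
# NUMBERS, keystone v6** — = v5 under the rulings of 2026-08-22 (lane INBOX 01:45:32Z, p3-g11): (L-F2) the near-`c` block read by the two LATTICE
# FUNCTIONALS `Λ₀ = |vβΔ₀ − vαΔ₁|`, `Λ₁ = |nΔ₁ − hΔ₀|` (`hΛR` per bridge frame sign, `hΛQ0/hΛQ1` hop prism, `hΛZ` zone box, and the fine extents
# `kA` from `hkA0/hkA1` by `abs_fineSkel_le_of_lam₂` — no per-axis extents `(sα, sβ)`), (L-F1) (ii) the y′-faces' bridge on the HOP SIDE `σhF du`
# (a sign per direction, chosen by the caller: `sgOf du · sgn⁺ v_α`; the bridge family `B` is read at that sign, the along y′-run keeps `sgOf du`),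
# (L-F5) the per-centre numbers in the v4 records `FaceRunNumsX4`/`FaceRunNumsY4` (served seed-generic clearances) through
# `hroute_of_faceRunNums_x5/_y5`; conclusion = the `hkits` binder of `faceOblRM_fineNb2`, verbatim. v5: for every face step of the twin scheme's exploration (`h, e, du, j, o`), every kit level `j'` has its `SHyp` datum with seeds off
# the support and faces well-connected to the target (`hkits_faceStepWNbG`, p299284), the exit pieces being the orientation-aware face table
# `pexFO` (p299393, `hPex_pexFO`), the subbox fact `isSubbox_faceStepWNb`, and the ROUTE at every centre `hroute_of_faceRunNums_x/_y` (R5a) fed by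
# the per-centre numbers `numsX/numsY : … → FaceRunNums …` (p300269); the realised radii of `concRadii2N` give `hR/hrim` from `r₀ + 1 ≤ 2L′`.
# What remains after this file: the served inputs (c-uniform, stmt-g14's servers), the integer floors, and the per-centre arithmetic (R5b).
builds on p205010 (kernel theorem, internal audit signed; external expert review pending) — nothing in this file uses p205010; no claim about the open node.
Lane `prim-bschramm`, seat `prim-hp-8` (gen 35); helper file (`--supports stmt-CriticalPhenomena-4575 --as helper`).
* **`Skelφ.hkits_faceSteps_of_nums6`** (supersedes `hkits_faceSteps_of_nums5`, p308065 = `hkits_faceSteps_of_nums4` with the per-centre numbers ALSO given the face-centre vertex `yF`,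
  `ψ yF = faceCen`, `pc = relφ yF` and `j < K` — what `cell_of_frame_box` needs to read the contact's cell); supersedes `hkits_faceSteps_of_nums4` (conclusion = the `hkits` binder of `faceOblRM_fineNb2`, verbatim; supersedes `hkits_faceSteps_of_nums`:
  the per-centre numbers target the history-free `targetMM` = `M ∪ RimG`, reachable by far last cores).
[cite: KozmaNitzan2024, §4 Lemma 10 (pp. 17–21), Lemma 12 (pp. 23–25), p. 30 (Step III)] [cite: MartineauTassion2017, §4.3 Lemma 4.2]
v7 note: v7 (hp-8 g36, 2026-08-22): the box-width binders carry the level floor `j₀ ≤ j` (D1: `KS.levels_wide` needs it; the old `∀ j ≤ j₁` form was unservable for thin bridge boxes) and the kit-excess hypothesis reads a GENERIC planar diameter `m` of the step region and a GENERIC entrance depth `ρZ` of the zone (D2: the old `box 2 (2·r)`/`Rs` reading was circular in `r`). The keystone DERIVES the kit worlds' diameter from `hdiam` (`stepRgNb_subset_Win`, `Win_farAS₂_subset_Efar_b`, `hdiam_fine_b`).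
v8 note: v8 (hp-8 g36, 2026-08-22 07:55Z): the numbers binders `numsX/numsY` and the caps `hnFx/hnFy` receive the realised-radius facts `L′ ≤ Λ.rM a′ (x + stepVec du)` and `r ≤ Λ.rE a′ x du` held at the call site (they fail at the root-adjacent face `a′ = 0, x + stepVec du = 0`, so a provider cannot know them for every `x`).
-/

noncomputable section

open MeasureTheory ProbabilityTheory
open scoped ENNReal Classical

namespace Summit.CriticalPhenomena.PercolationContinuityZ3.Theorems.Transplant

namespace Skelφ

open Literature.Probability.Percolation Literature.Probability.LatticeModels SimpleGraph GadgetSystem Contour KNCells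
open Literature.Probability.Percolation.KozmaNitzan
open Literature.Probability.Percolation.KozmaNitzan.Cells (oth oth_ne sgOf sgOf_sign stepVec_apply_fst eq_oth_of_ne oth_oth)
open KNLevels ChainPlanar ChainPara
open Literature.Barriers.CriticalPhenomena (graphBall mem_graphBall_self graphBall_mono)
open BoxProdZ2 (ConcRadiiG Erad Frad nQ nS Realised Frad_succ Frad_le_Erad)
open Skel (winGraph routeW excess WinStepData)
open SkelI (tanOff)
open TwoAxis.Para (modulus detD)

variable {V : Type} [DecidableEq V] [Countable V] {G : SimpleGraph V} [G.LocallyFinite] {φ : V → Site 2}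

/-- **THE `hkits` HYPOTHESIS OF `faceOblRM_fineNb2` FROM THE KIT INPUTS AND THE PER-CENTRE NUMBERS** (see the module docstring).
[cite: KozmaNitzan2024, §4 Lemma 10 (pp. 17–21), Lemma 12 (pp. 23–25), p. 30 (Step III)] -/
theorem hkits_faceSteps_of_nums8 {types : Finset V} (hlipφ : Lip G φ) (hstep : Steps G φ) (hfr : Frames G φ types) (hκ : CylConn G φ types)
    {Δg : ℕ} (hΔg : ∀ v, G.degree v ≤ Δg)
    -- the twin scheme over the fine skeleton at `w₀`
    (pr : FinePrm) (w₀ : V) (P : PCells2) (gap gap' : ℕ → ℕ) (E₀ L' : ℕ) (off : Site 2 → ℕ) (b₀ : Fin 2 → ℕ) (q : unitInterval) (δc : ℝ)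
    (hb₀ : ∀ i, b₀ i ≤ 3 * P.r i) (hc₀ : 0 < pr.c₀) (hc₁ : 0 < pr.c₁) (hDd : pr.D = detD pr.A pr.n pr.h pr.vα pr.vβ) (hD : 0 < pr.D)
    (hL0 : pr.c₀ * pr.L 0 + 2 ≤ pr.D) (hL1 : pr.c₁ * pr.L 1 + 2 ≤ pr.D) (hA0 : 0 < pr.A) {nL : ℕ} (hnL : 1 ≤ nL) (hvL : |pr.vα| ≤ nL)
    (hmf : 0 ≤ modulus nL pr.h pr.vα pr.vβ)
    (hgap : ∀ n, 1 ≤ gap n) (hE₀ : 2 ≤ E₀) (hL' : 1 ≤ L') {c : ℕ} {R₁' : ℕ → ℕ} (hgapR : ∀ ρ, c + 2 * L' + R₁' ρ + 2 ≤ gap ρ)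
    -- the face-frame data per direction
    (aw : MDir → ℕ) (Rlev N M : ℕ) {k₀ : ℤ} {kF : Fin 2 → ℤ} (hk₀ : ∀ I, pr.rdN I (pr.bOf I) ≤ pr.rdK I (pr.bOf I) * k₀)
    (hk₀' : ∀ i, 3 * (P.r i : ℤ) + k₀ + 3 ≤ 5 * P.r i)
    (hRlev : ∀ i, Rlev + 4 ≤ 10 * P.s i) (hRlev' : ∀ i, Rlev + 4 ≤ 3 * P.r i)
    (hroomF : ∀ du : MDir,
      pr.Mabs * (aw du + Rlev + 1) + pr.rdN du.1 (pr.bOf du.1) * (Rlev + 2) * pr.D ≤ pr.rdK du.1 (pr.bOf du.1) * kF du.1 * pr.D)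
    (hkF : ∀ I, kF I + 3 ≤ 5 * (P.r (oth I) : ℤ)) {nF : Fin 2 → ℕ} (hnC : ∀ I, (nF I : ℤ) ≤ pr.cOf I * |pr.A| * |pr.lvGen I (pr.bOf I)|)
    (hU3 : ∀ I, pr.D ≤ 3 * (nF I : ℤ)) {E r : ℕ} {δ₂ : ℝ} (hδ₂ : 0 < δ₂)
    -- THE ROUTE BLOCK (c-uniform; all signs)
    (B : ℤ → BridgePrm) (hB : ∀ σ' : ℤ, σ' = 1 ∨ σ' = -1 → BridgeOK (B σ')) (σhF : MDir → ℤ) (hσhF : ∀ du : MDir, σhF du = 1 ∨ σhF du = -1)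
    {kq : ℕ} (hκL : pr.h.natAbs ≤ kq * nL) (ℓ' R's qB Rl R'₃ qB₃ : ℕ)
    (hlay : (nL + pr.h.natAbs : ℕ) ≤ (nL : ℤ) * ℓ' + 1)
    (Rlev₁ N₁ j₀₁ j₁₁ Rlev₂ N₂ j₀₂ j₁₂ Rlev₃ N₃' j₀₃ j₁₃ : ℕ) (hRl₁ : ∀ σ' : ℤ, σ' = 1 ∨ σ' = -1 → Rlev₁ + 1 ≤ (B σ').R') (hRl₂ : Rlev₂ + 1 ≤ R's) (hRl₃ : Rlev₃ + 1 ≤ R'₃)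
    (hj₁ : j₁₁ ≤ Rlev₁) (hj₂ : j₁₂ ≤ Rlev₂) (hj₃ : j₁₃ ≤ Rlev₃)
    (hB0 : ∀ σ' : ℤ, σ' = 1 ∨ σ' = -1 → Finset.Icc (pt nL (σ' * pr.h)) (pt nL (σ' * pr.h + ℓ')) ⊆ Finset.Icc (B σ').B₀lo (B σ').B₀hi) (hRlr : Rl ≤ r)
    -- the near-`c` block READ BY THE TWO LATTICE FUNCTIONALS (L-F2): bridge regions (every frame sign), hop prism, zone box, fine extents `kA`
    {Λ₀ Λ₁ : ℤ} {kA : Fin 2 → ℤ}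
    (hΛR : ∀ σ' : ℤ, σ' = 1 ∨ σ' = -1 → ∀ x ∈ Finset.Icc (B σ').regionLo (B σ').regionHi, |pr.vβ * (σ' * x 0) - pr.vα * x 1| ≤ Λ₀ ∧ |(nL : ℤ) * x 1 - pr.h * (σ' * x 0)| ≤ Λ₁)
    (hΛQ0 : modulus nL pr.h pr.vα pr.vβ + (nL : ℤ) * ((3 * ℓ' : ℕ) : ℤ) ≤ Λ₀) (hΛQ1 : (nL : ℤ) * ((3 * ℓ' : ℕ) : ℤ) ≤ Λ₁) {Mz : ℕ}
    (hΛZ : (|pr.vβ| + |pr.vα|) * (Mz : ℤ) ≤ Λ₀ ∧ ((nL : ℤ) + |pr.h|) * (Mz : ℤ) ≤ Λ₁)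
    (hkA0 : pr.c₀ * (|pr.A| * Λ₀) ≤ kA 0 * pr.D) (hkA1 : pr.c₁ * (|pr.A| * Λ₁) ≤ kA 1 * pr.D)
    {kb : ℕ} (hkbMz : (Mz : ℤ) ≤ kb) (hπ1 : ∀ σ' : ℤ, σ' = 1 ∨ σ' = -1 → ((B σ').core1Lo 0).natAbs + ((B σ').core1Lo 1).natAbs ≤ r)
    (hclr₁ : ∀ σ' : ℤ, σ' = 1 ∨ σ' = -1 → (kb : ℤ) < (B σ').B₀lo 0 - (B σ').R' - (B σ').pr)
    {Δ' : ℕ} {δ η : ℝ} (hδ : 0 < δ) (hδ1 : δ ≤ 1) (nF : ℕ)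
    -- the inner-chain fact UP TO THE LENGTH BUDGET `nF` (p3-g11 2026-08-22T02:23:54Z; the wrapper discharges it by `ChainFactF` at `n ≤ LfA K₀`)
    (hchain : ∀ (c : V) (Nr N₃ : ℕ), 0 + 1 + Nr + 1 + N₃ ≤ nF → ∀ (W : Sym2 V → unitInterval) (s : Fin (0 + 1 + Nr + 1 + N₃ + 1) → TStep (winGraph G c r))
      (T' : Fin (0 + 1 + Nr + 1 + N₃ + 1) → Finset V) (η : ℝ),
      (∀ i, (s i).L.o = (s 0).L.o) →
      (∀ i : Fin (0 + 1 + Nr + 1 + N₃), T' (Fin.castSucc i) ⊆ (s i.succ).L.X 0) →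
      (∀ i, T' i ⊆ (s i).T) →
      (∀ i, (s i).KitsAt W q Δ' δ) →
      η ≤ δ / 2 →
      (∀ i, (prodBernoulli W).real (⋃ t ∈ (s i).T \ T' i, openConn (s 0).L.o t) ≤ η) →
      1 - δ < (prodBernoulli W).real (s 0).L.reachB →
        1 - δ₂ ^ 2 < (prodBernoulli W).real (⋃ t ∈ T' (Fin.last (0 + 1 + Nr + 1 + N₃)), openConn (s 0).L.o t))
    (hcount₁ : 1 / (1 - (q : ℝ)) ^ (Δ' * N₁) ≤ δ * ((Finset.Icc j₀₁ j₁₁).card : ℝ))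
    (hcount₂ : 1 / (1 - (q : ℝ)) ^ (Δ' * N₂) ≤ δ * ((Finset.Icc j₀₂ j₁₂).card : ℝ))
    (hcount₃ : 1 / (1 - (q : ℝ)) ^ (Δ' * N₃') ≤ δ * ((Finset.Icc j₀₃ j₁₃).card : ℝ))
    (hη : η ≤ δ / 2)
    (Pb Pr : ApronPrm) {Rs Kmaxb KCmaxb Kmaxr KCmaxr rsb rsr cSb cSr cU r₁ r₂ Rb : ℕ}
    (hPNb : 1 ≤ Pb.N) (hAb : Pb.A = (Mz : ℤ) + 2)
    (hd1b : Pb.W + Pb.ℓ ≤ Pb.d) (hD1b : Pb.W + Pb.ℓ + Pb.d + 2 ≤ shellD Pb) (hD2b : Pb.ℓ + Rs + Pb.d + 3 ≤ shellD Pb) (hDρb : Rs + 1 ≤ shellD Pb)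
    (hℓb : 1 ≤ Pb.ℓ) (hWb : Rs + Pb.ℓ ≤ Pb.W) (hKmaxb : shellD Pb + Pb.W ≤ Kmaxb) (hKCmaxb : shellD Pb + Mz + 1 ≤ KCmaxb)
    (hR'b : cylRadMax G φ types Pb.ℓ (Rs + KCmaxb + (Pb.W + Kmaxb)) ≤ Pb.R')
    (hwideb : ∀ σ' : ℤ, σ' = 1 ∨ σ' = -1 → ∀ j, j₀₁ ≤ j → j ≤ j₁₁ → ∀ i, ((B σ').B₀lo - (j : Site 2)) i + 2 * tanOff Pb.ℓs Pb.M ≤ ((B σ').B₀hi + (j : Site 2)) i)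
    (hdwb : ∀ σ' : ℤ, σ' = 1 ∨ σ' = -1 → ∀ j, j₀₁ ≤ j → j ≤ j₁₁ → ∀ i, ((B σ').B₀lo - (j : Site 2)) i + (Pb.d + 2 : ℕ) ≤ ((B σ').B₀hi + (j : Site 2)) i)
    (hDwb : ∀ σ' : ℤ, σ' = 1 ∨ σ' = -1 → ∀ j, j₀₁ ≤ j → j ≤ j₁₁ → ∀ i, ((B σ').B₀lo - (j : Site 2)) i + ((shellD Pb + 1 + Pb.d + KCmaxb + Rs : ℕ) : ℤ) ≤ ((B σ').B₀hi + (j : Site 2)) i)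
    (hTb : (Pb.W : ℤ) + Kmaxb + Pb.ℓ + 1 ≤ tanOff Pb.ℓs Pb.M) (hT'b : (shellD Pb : ℤ) + KCmaxb + Rs ≤ tanOff Pb.ℓs Pb.M)
    (hr₀b : Pb.N * (tanOff Pb.ℓs Pb.M + 2) + Pb.N * Pb.d + (Pb.W + Kmaxb + Pb.R') + (KCmaxb + Rs) ≤ Pb.r₀) (hRb₀ : Pb.r₀ ≤ r)
    (hrsb : 2 * (1 + Pb.N * (tanOff Pb.ℓs Pb.M + 2) + Pb.N * Pb.d + (Pb.W + Kmaxb + Pb.R') + (KCmaxb + Rs)) ≤ rsb)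
    (hcSb : (Pb.N + 1) * (tanOff Pb.ℓs Pb.M + 1) + (Pb.N + 1) * Pb.d + (2 * Pb.W + 1) * (Kmaxb + 1) * (Δg + 1) ^ Pb.R' ≤ cSb)
    (hEb : ∀ σ' : ℤ, σ' = 1 ∨ σ' = -1 → j₁₁ + (Pb.N * (tanOff Pb.ℓs Pb.M + 1) + Pb.N * Pb.d + KCmaxb) ≤ (B σ').R')
    (hreachb : r₁ + (Pb.N * (tanOff Pb.ℓs Pb.M + 1) + Pb.N * Pb.d + KCmaxb) ≤ Pb.r₀) (hr₁ : Rb ≤ r₁) (hr₁R : r₁ ≤ r)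
    (hPNr : kq + 3 ≤ Pr.N) (hAr : Pr.A = (Mz + 1 : ℕ) * (shearUnit nL pr.h : ℤ) + 1)
    (hd1r : Pr.W + Pr.ℓ ≤ Pr.d) (hD1r : Pr.W + Pr.ℓ + Pr.d + 2 ≤ shellD Pr) (hD2r : Pr.ℓ + Rs + Pr.d + 3 ≤ shellD Pr) (hDρr : Rs + 1 ≤ shellD Pr)
    (hℓr : 1 ≤ Pr.ℓ) (hWr : Rs + Pr.ℓ ≤ Pr.W) (hKmaxr : (shellD Pr + Pr.W) * (kq + 1) ≤ Kmaxr) (hKCmaxr : (shellD Pr + Mz + 1) * (kq + 1) ≤ KCmaxr)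
    (hR'r : cylRadMax G φ types Pr.ℓ (Rs + KCmaxr + (Pr.W + Kmaxr)) ≤ Pr.R')
    (hwider : ∀ Nr, ∀ k ≤ Nr, ∀ j, j₀₂ ≤ j → j ≤ j₁₂ → ∀ i, ((xRunSched nL ℓ' pr.h R's qB Nr).lo k - (j : Site 2)) i + 2 * tanOff Pr.ℓs Pr.M ≤
      ((xRunSched nL ℓ' pr.h R's qB Nr).hi k + (j : Site 2)) i)
    (hdwr : ∀ Nr, ∀ k ≤ Nr, ∀ j, j₀₂ ≤ j → j ≤ j₁₂ → ∀ i, ((xRunSched nL ℓ' pr.h R's qB Nr).lo k - (j : Site 2)) i + (Pr.d + 2 : ℕ) ≤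
      ((xRunSched nL ℓ' pr.h R's qB Nr).hi k + (j : Site 2)) i)
    (hDwr : ∀ Nr, ∀ k ≤ Nr, ∀ j, j₀₂ ≤ j → j ≤ j₁₂ → ∀ i, ((xRunSched nL ℓ' pr.h R's qB Nr).lo k - (j : Site 2)) i + ((shellD Pr + 1 + Pr.d + KCmaxr + Rs : ℕ) : ℤ) ≤
      ((xRunSched nL ℓ' pr.h R's qB Nr).hi k + (j : Site 2)) i)
    (hwidey : ∀ N₃, ∀ k ≤ N₃, ∀ j, j₀₃ ≤ j → j ≤ j₁₃ → ∀ i, ((yRunSched hnL hvL hlay R'₃ qB₃ N₃).lo k - (j : Site 2)) i + 2 * tanOff Pr.ℓs Pr.M ≤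
      ((yRunSched hnL hvL hlay R'₃ qB₃ N₃).hi k + (j : Site 2)) i)
    (hdwy : ∀ N₃, ∀ k ≤ N₃, ∀ j, j₀₃ ≤ j → j ≤ j₁₃ → ∀ i, ((yRunSched hnL hvL hlay R'₃ qB₃ N₃).lo k - (j : Site 2)) i + (Pr.d + 2 : ℕ) ≤
      ((yRunSched hnL hvL hlay R'₃ qB₃ N₃).hi k + (j : Site 2)) i)
    (hDwy : ∀ N₃, ∀ k ≤ N₃, ∀ j, j₀₃ ≤ j → j ≤ j₁₃ → ∀ i, ((yRunSched hnL hvL hlay R'₃ qB₃ N₃).lo k - (j : Site 2)) i + ((shellD Pr + 1 + Pr.d + KCmaxr + Rs : ℕ) : ℤ) ≤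
      ((yRunSched hnL hvL hlay R'₃ qB₃ N₃).hi k + (j : Site 2)) i)
    (hwiderY : ∀ Nr, ∀ k ≤ Nr, ∀ j, j₀₂ ≤ j → j ≤ j₁₂ → ∀ i, ((yRunSched hnL hvL hlay R's qB Nr).lo k - (j : Site 2)) i + 2 * tanOff Pr.ℓs Pr.M ≤
      ((yRunSched hnL hvL hlay R's qB Nr).hi k + (j : Site 2)) i)
    (hdwrY : ∀ Nr, ∀ k ≤ Nr, ∀ j, j₀₂ ≤ j → j ≤ j₁₂ → ∀ i, ((yRunSched hnL hvL hlay R's qB Nr).lo k - (j : Site 2)) i + (Pr.d + 2 : ℕ) ≤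
      ((yRunSched hnL hvL hlay R's qB Nr).hi k + (j : Site 2)) i)
    (hDwrY : ∀ Nr, ∀ k ≤ Nr, ∀ j, j₀₂ ≤ j → j ≤ j₁₂ → ∀ i, ((yRunSched hnL hvL hlay R's qB Nr).lo k - (j : Site 2)) i + ((shellD Pr + 1 + Pr.d + KCmaxr + Rs : ℕ) : ℤ) ≤
      ((yRunSched hnL hvL hlay R's qB Nr).hi k + (j : Site 2)) i)
    (hwideyY : ∀ N₃, ∀ k ≤ N₃, ∀ j, j₀₃ ≤ j → j ≤ j₁₃ → ∀ i, ((xRunSched nL ℓ' pr.h R'₃ qB₃ N₃).lo k - (j : Site 2)) i + 2 * tanOff Pr.ℓs Pr.M ≤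
      ((xRunSched nL ℓ' pr.h R'₃ qB₃ N₃).hi k + (j : Site 2)) i)
    (hdwyY : ∀ N₃, ∀ k ≤ N₃, ∀ j, j₀₃ ≤ j → j ≤ j₁₃ → ∀ i, ((xRunSched nL ℓ' pr.h R'₃ qB₃ N₃).lo k - (j : Site 2)) i + (Pr.d + 2 : ℕ) ≤
      ((xRunSched nL ℓ' pr.h R'₃ qB₃ N₃).hi k + (j : Site 2)) i)
    (hDwyY : ∀ N₃, ∀ k ≤ N₃, ∀ j, j₀₃ ≤ j → j ≤ j₁₃ → ∀ i, ((xRunSched nL ℓ' pr.h R'₃ qB₃ N₃).lo k - (j : Site 2)) i + ((shellD Pr + 1 + Pr.d + KCmaxr + Rs : ℕ) : ℤ) ≤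
      ((xRunSched nL ℓ' pr.h R'₃ qB₃ N₃).hi k + (j : Site 2)) i)
    (hTr : (Pr.W : ℤ) + Kmaxr + Pr.ℓ + 1 ≤ tanOff Pr.ℓs Pr.M) (hT'r : (shellD Pr : ℤ) + KCmaxr + Rs ≤ tanOff Pr.ℓs Pr.M)
    (hr₀r : Pr.N * (tanOff Pr.ℓs Pr.M + 2) + Pr.N * Pr.d + (Pr.W + Kmaxr + Pr.R') + (KCmaxr + Rs) ≤ Pr.r₀) (hRr₀ : Pr.r₀ ≤ r)
    (hrsr : 2 * (1 + Pr.N * (tanOff Pr.ℓs Pr.M + 2) + Pr.N * Pr.d + (Pr.W + Kmaxr + Pr.R') + (KCmaxr + Rs)) ≤ rsr)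
    (hcSr : (Pr.N + 1) * (tanOff Pr.ℓs Pr.M + 1) + (Pr.N + 1) * Pr.d + (2 * Pr.W + 1) * (Kmaxr + 1) * (Δg + 1) ^ Pr.R' ≤ cSr)
    (hEr : j₁₂ + (Pr.N * (tanOff Pr.ℓs Pr.M + 1) + Pr.N * Pr.d + KCmaxr) ≤ R's)
    (hEy : j₁₃ + (Pr.N * (tanOff Pr.ℓs Pr.M + 1) + Pr.N * Pr.d + KCmaxr) ≤ R'₃)
    (hreachr : r₂ + (Pr.N * (tanOff Pr.ℓs Pr.M + 1) + Pr.N * Pr.d + KCmaxr) ≤ Pr.r₀) (hr₂ : Rl ≤ r₂) (hr₂R : r₂ ≤ r)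
    (QK : ShortPcO V) (hRgRs : ∀ c', QK.RS c' ≤ Rs) (hRgcard : ∀ c', (RgO G φ QK c').card ≤ cU) (hcU1 : 1 ≤ cU)
    (hnSK : ∀ c', 22 * Mz + 58 ≤ QK.nS c') (hκSK : ∀ c', |QK.hS c'| ≤ 10 * (QK.nS c' : ℤ)) (hℓSK : ∀ c', 24 * Mz + 64 ≤ QK.ℓS c')
    (hκL10 : |pr.h| ≤ 10 * (nL : ℤ))
    (Λc : V → ℕ → Finset V) (kz : ℕ) (hkn : ∀ c', Λc c' kz ⊆ Λc c' Mz) (hΛ : ∀ c', ∀ v ∈ Λc c' Mz, v ∈ RgO G φ QK c' ∧ φ v - φ c' ∈ box 2 Mz)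
    (hZ : ∀ c', (↑(Λc c' Mz) : Set V) ⊆ cyl φ c' Mz) (hMz : Mz < nL) (hclrz : (Mz + 4) * (nL + pr.h.natAbs) ≤ nL * (ℓ' + 1))
    (hcz : ∀ c, c ∈ Λc c kz) (hzconn : ∀ c, ∀ s ∈ Λc c kz, PathIn G (↑(Λc c kz) : Set V) c s) (hRsr : Rs ≤ r)
    {ρZ : ℕ} (hZρ : ∀ c', ∀ s ∈ Λc c' kz, s ∈ graphBall G c' ρZ) (hρr : ρZ ≤ r)
    (hZU : ∀ c, Λc c kz ⊆ pgramPrismFin G φ c nL pr.h (3 * ℓ') Rl)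
    (Qb Fb : ℤ → V → Finset V)
    (hQb : ∀ σ' : ℤ, σ' = 1 ∨ σ' = -1 → ∀ c c', ∀ w ∈ Qb σ' c', w ∈ graphBall G c' Rb ∧
      rootFrame φ c σ' w ∈ Finset.Icc (rootFrame φ c σ' c' - (((B σ').pr : ℕ) : Site 2)) (rootFrame φ c σ' c' + (((B σ').pr : ℕ) : Site 2)))
    (hFb : ∀ σ' : ℤ, σ' = 1 ∨ σ' = -1 → ∀ c c', ∀ w ∈ Fb σ' c', w ∈ Qb σ' c' ∧
      rootFrame φ c σ' w ∈ Finset.Icc (rootFrame φ c σ' c' + (B σ').dlo) (rootFrame φ c σ' c' + (B σ').dhi))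
    (hFZ : ∀ σ' : ℤ, σ' = 1 ∨ σ' = -1 → ∀ c', Disjoint (Fb σ' c') (Λc c' Mz))
    (kk₁ kk₂ kk₃ : ℕ) (hkN₁ : kk₁ * (Δg + 1) ^ (2 * rsb) ≤ N₁) (hkN₂ : kk₂ * (Δg + 1) ^ (2 * rsr) ≤ N₂) (hkN₃ : kk₃ * (Δg + 1) ^ (2 * rsr) ≤ N₃')
    (hk₁ : (1 - (q : ℝ) ^ (1 + Δg * cSb + cSb * cU)) ^ kk₁ ≤ δ) (hk₂ : (1 - (q : ℝ) ^ (1 + Δg * cSr + cSr * cU)) ^ kk₂ ≤ δ)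
    (hk₃ : (1 - (q : ℝ) ^ (1 + Δg * cSr + cSr * cU)) ^ kk₃ ≤ δ)
    (hzone : ∀ c', 1 - δ ^ 2 < (bondPercolation G q).real (UniqZone.zone G (Λc c') kz Mz))
    (hexitb : ∀ σ' : ℤ, σ' = 1 ∨ σ' = -1 → ∀ c' (i : Fin 2) (σ₀ : ℤˣ), 1 - δ ^ 2 < (bondPercolation G q).real
      (linkIn (↑(RgO G φ QK c') : Set V) (Λc c' kz) (pexRO G φ QK Mz Pb.A σ' i σ₀ c')))
    (hexitr : ∀ σ' : ℤ, σ' = 1 ∨ σ' = -1 → ∀ c' (i : Fin 2) (σ₀ : ℤˣ), 1 - δ ^ 2 < (bondPercolation G q).real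
      (linkIn (↑(RgO G φ QK c') : Set V) (Λc c' kz) (pexXO G φ QK Mz nL pr.h Pr.A σ' i σ₀ c')))
    (hexity : ∀ σT : ℤ, σT = 1 ∨ σT = -1 → ∀ c' (i : Fin 2) (σ₀ : ℤˣ), 1 - δ ^ 2 < (bondPercolation G q).real
      (linkIn (↑(RgO G φ QK c') : Set V) (Λc c' kz) (pexYO G φ QK Mz nL pr.h Pr.A σT i σ₀ c')))
    (hbridge : ∀ σ' : ℤ, σ' = 1 ∨ σ' = -1 → ∀ c', 1 - δ ^ 2 < (bondPercolation G q).real (linkIn (↑(Qb σ' c') : Set V) (Λc c' kz) (Fb σ' c')))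
    (hlongx : ∀ σ' : ℤ, σ' = 1 ∨ σ' = -1 → ∀ c' (τ : ℤ), τ = 1 ∨ τ = -1 → 1 - δ ^ 2 < (bondPercolation G q).real
      (linkIn (pgramPrism G φ c' nL pr.h (3 * ℓ') Rl) (Λc c' kz) (pgSideHalfW G φ c' nL pr.h ℓ' Rl σ' (σ' * τ))))
    (hlongy : ∀ σT : ℤ, σT = 1 ∨ σT = -1 → ∀ c' (τ : ℤ), τ = 1 ∨ τ = -1 → 1 - δ ^ 2 < (bondPercolation G q).real
      (linkIn (pgramPrism G φ c' nL pr.h (3 * ℓ') Rl) (Λc c' kz) (pgTopPieceW G φ c' nL pr.h ℓ' Rl σT τ pr.vα)))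
    -- the planar diameter of the face regions (fineNb2's `hdiam`): it bounds the kit worlds too
    {m : ℕ} (hdiam : ∀ b' : Fin 2, (pr.rdK 1 b' + pr.rdK 0 b') * ((50 * P.rmax : ℕ) + 1) * pr.D ≤ pr.Mabs * (m + 1))
    {R₁ : ℕ}
    (hR₁ : ∀ (c' : V) (R' : ℕ), R₁ ≤ R' → ∀ (Rw : ℕ) (D' B' : Finset V), (∀ d ∈ D', d ∈ graphBall G c' Rw) →
      (∀ d ∈ D', ∀ d' ∈ D', φ d - φ d' ∈ box 2 m) → B' ⊆ D' → (∀ a ∈ B', a ∈ graphBall G c' ρZ) →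
        (bondPercolation G q).real (excess G c' R' D' B') ≤ η)
    (hR₁b : R₁ ≤ r - Pb.r₀) (hR₁r : R₁ ≤ r - Pr.r₀)
    -- the FACE KIT: constants, exit table rooms, reach, inputs at accuracy `δ₂`
    (PA : ApronPrm) {Kmax KCmax rs cS : ℕ} (hPN : 3 ≤ PA.N) (hA : PA.A = (Mz + 1 : ℕ) * pr.D + 1)
    (hd1 : PA.W + PA.ℓ ≤ PA.d) (hD1 : PA.W + PA.ℓ + PA.d + 2 ≤ shellD PA) (hD2 : PA.ℓ + Rs + PA.d + 3 ≤ shellD PA) (hDρ : Rs + 1 ≤ shellD PA)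
    (hℓ : 1 ≤ PA.ℓ) (hW : Rs + PA.ℓ ≤ PA.W) (hKmax : (shellD PA + PA.W) * 3 ≤ Kmax) (hKCmax : (shellD PA + Mz + 1) * 3 ≤ KCmax)
    (hR' : cylRadMax G φ types PA.ℓ (Rs + KCmax + (PA.W + Kmax)) ≤ PA.R')
    (hMtan : tanOff PA.ℓs PA.M ≤ (M : ℤ) + 1) (hMd : PA.d + 2 ≤ 2 * M + 2) (hMD : shellD PA + 1 + PA.d + KCmax + Rs ≤ 2 * M + 2)
    (hT : (PA.W : ℤ) + Kmax + PA.ℓ + 1 ≤ tanOff PA.ℓs PA.M) (hT' : (shellD PA : ℤ) + KCmax + Rs ≤ tanOff PA.ℓs PA.M)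
    (hr₀ : PA.N * (tanOff PA.ℓs PA.M + 2) + PA.N * PA.d + (PA.W + Kmax + PA.R') + (KCmax + Rs) ≤ PA.r₀) (hr₀L : PA.r₀ + 1 ≤ 2 * L')
    (hrs : 2 * (1 + PA.N * (tanOff PA.ℓs PA.M + 2) + PA.N * PA.d + (PA.W + Kmax + PA.R') + (KCmax + Rs)) ≤ rs)
    (hcS : (PA.N + 1) * (tanOff PA.ℓs PA.M + 1) + (PA.N + 1) * PA.d + (2 * PA.W + 1) * (Kmax + 1) * (Δg + 1) ^ PA.R' ≤ cS)
    (hE : Rlev + (PA.N * (tanOff PA.ℓs PA.M + 1) + PA.N * PA.d + KCmax) ≤ E)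
    (hreach : r + (PA.N * (tanOff PA.ℓs PA.M + 1) + PA.N * PA.d + KCmax) ≤ PA.r₀)
    {C MK : ℕ} (hn1 : ∀ c', 1 ≤ QK.nS c') (hEq : ∀ c', ((MK : ℤ) + 1) * (QK.nS c' + |QK.hS c'|) ≤ (QK.nS c' : ℤ) * (QK.ℓS c' + 1))
    (hM4 : 4 * C + 1 ≤ MK) (hn2 : ∀ c', 2 * C ≤ QK.nS c') {kL : Fin 2 → ℤ} (hexitR : PA.A + 2 * pr.D ≤ (C : ℤ) * pr.D)
    (hexitL : ∀ I, PA.A + pr.climC I (pr.bOf I) I + pr.D ≤ kL I * pr.D) (hkC : ∀ I, (kL I + 1) * pr.D ≤ (C : ℤ) * (pr.cOf I * pr.L I))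
    (kk : ℕ) (hN : kk * (Δg + 1) ^ (2 * rs) ≤ N) (hk : (1 - (q : ℝ) ^ (1 + Δg * cS + cS * cU)) ^ kk ≤ δ₂)
    (hzoneK : ∀ c', 1 - δ₂ ^ 2 < (bondPercolation G q).real (UniqZone.zone G (Λc c') kz Mz))
    (hexitK : ∀ (I : Fin 2) c' (i : Fin 2) (σ₀ : ℤˣ), 1 - δ₂ ^ 2 < (bondPercolation G q).real
      (linkIn (↑(RgO G φ QK c') : Set V) (Λc c' kz) (pr.pexFO G φ I (pr.bOf I) QK C i σ₀ c')))
    -- THE PER-CENTRE NUMBERS (x-faces `du.1 = 0`, y′-faces `du.1 = 1`)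
    (numsX : ∀ (a' : ℕ) (x : Site 2) (du : MDir) (j : ℕ) (pc : ℤ) (c' : V), du.1 = 0 → j < P.K → ∀ yF : V,
      pr.ψ φ w₀ yF = P.faceCen x du j → pc = relφ φ w₀ yF (pr.bOf du.1) →
      pr.frame φ w₀ du.1 (pr.bOf du.1) c' ∈ Finset.Icc (loN P x du j pc (aw du) - ((E : ℕ) : Site 2)) (hiN P x du j pc (aw du) + ((E : ℕ) : Site 2)) →
      c' ∈ graphBall G w₀ ((concRadii2N P gap gap' E₀ L' off).rE a' x du - r) →
      L' ≤ (concRadii2N P gap gap' E₀ L' off).rM a' (x + stepVec du) → r ≤ (concRadii2N P gap gap' E₀ L' off).rE a' x du →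
      FaceRunNumsX4 G φ (pr.ψ φ w₀) c' pr.A nL pr.h pr.vα pr.vβ pr.c₀ pr.c₁ pr.D du (sgOf du) (B (sgOf du)) ℓ' R's qB R'₃ qB₃ pr.vα hnL hvL hlay Mz
        (P.farCore x du j k₀) (targetMM G φ pr P w₀ (concRadii2N P gap gap' E₀ L' off) b₀ a' x du L') (Λc c' Mz) r (kA du.1) (kA (oth du.1)))
    (numsY : ∀ (a' : ℕ) (x : Site 2) (du : MDir) (j : ℕ) (pc : ℤ) (c' : V), du.1 = 1 → j < P.K → ∀ yF : V,
      pr.ψ φ w₀ yF = P.faceCen x du j → pc = relφ φ w₀ yF (pr.bOf du.1) →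
      pr.frame φ w₀ du.1 (pr.bOf du.1) c' ∈ Finset.Icc (loN P x du j pc (aw du) - ((E : ℕ) : Site 2)) (hiN P x du j pc (aw du) + ((E : ℕ) : Site 2)) →
      c' ∈ graphBall G w₀ ((concRadii2N P gap gap' E₀ L' off).rE a' x du - r) →
      L' ≤ (concRadii2N P gap gap' E₀ L' off).rM a' (x + stepVec du) → r ≤ (concRadii2N P gap gap' E₀ L' off).rE a' x du →
      FaceRunNumsY4 G φ (pr.ψ φ w₀) c' pr.A nL pr.h pr.vα pr.vβ pr.c₀ pr.c₁ pr.D du (σhF du) (sgOf du) (B (σhF du)) ℓ' R's qB R'₃ qB₃ pr.vα hnL hvL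
        hlay Mz (P.farCore x du j k₀) (targetMM G φ pr P w₀ (concRadii2N P gap gap' E₀ L' off) b₀ a' x du L') (Λc c' Mz) r (kA du.1) (kA (oth du.1)))
    -- the providers' stride counts within the budget
    (hnFx : ∀ (a' : ℕ) (x : Site 2) (du : MDir) (j : ℕ) (pc : ℤ) (c' : V) (hI : du.1 = 0) (hj : j < P.K) (yF : V)
      (hyF : pr.ψ φ w₀ yF = P.faceCen x du j) (hpc : pc = relφ φ w₀ yF (pr.bOf du.1))
      (h1 : pr.frame φ w₀ du.1 (pr.bOf du.1) c' ∈ Finset.Icc (loN P x du j pc (aw du) - ((E : ℕ) : Site 2)) (hiN P x du j pc (aw du) + ((E : ℕ) : Site 2)))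
      (h2 : c' ∈ graphBall G w₀ ((concRadii2N P gap gap' E₀ L' off).rE a' x du - r))
      (hM : L' ≤ (concRadii2N P gap gap' E₀ L' off).rM a' (x + stepVec du)) (hE : r ≤ (concRadii2N P gap gap' E₀ L' off).rE a' x du),
      0 + 1 + (numsX a' x du j pc c' hI hj yF hyF hpc h1 h2 hM hE).Nr + 1 + (numsX a' x du j pc c' hI hj yF hyF hpc h1 h2 hM hE).N₃ ≤ nF)
    (hnFy : ∀ (a' : ℕ) (x : Site 2) (du : MDir) (j : ℕ) (pc : ℤ) (c' : V) (hI : du.1 = 1) (hj : j < P.K) (yF : V)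
      (hyF : pr.ψ φ w₀ yF = P.faceCen x du j) (hpc : pc = relφ φ w₀ yF (pr.bOf du.1))
      (h1 : pr.frame φ w₀ du.1 (pr.bOf du.1) c' ∈ Finset.Icc (loN P x du j pc (aw du) - ((E : ℕ) : Site 2)) (hiN P x du j pc (aw du) + ((E : ℕ) : Site 2)))
      (h2 : c' ∈ graphBall G w₀ ((concRadii2N P gap gap' E₀ L' off).rE a' x du - r))
      (hM : L' ≤ (concRadii2N P gap gap' E₀ L' off).rM a' (x + stepVec du)) (hE : r ≤ (concRadii2N P gap gap' E₀ L' off).rE a' x du),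
      0 + 1 + (numsY a' x du j pc c' hI hj yF hyF hpc h1 h2 hM hE).Nr + 1 + (numsY a' x du j pc c' hI hj yF hyF hpc h1 h2 hM hE).N₃ ≤ nF) :
    ∀ (h : ProbeHistory V) (e : Site 2 × MDir),
      let Λ := concRadii2N P gap gap' E₀ L' off
      let S : KSchA V ℕ := ⟨cellGeomSG₂b G (pr.ψ φ w₀) P w₀ Λ b₀, q, δc⟩
      S.IsRun₂ G h → (S.astOf₂ G h).st.choice = some e → S.Valid₂ G h e →
      ∀ du ∈ S.onward G h (tgt e), ∀ j < P.K, ∀ o : Finset (Sym2 V), ∀ (yF : V) (pc : ℤ),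
      pr.ψ φ w₀ yF = P.faceCen (tgt e) du j → pc = relφ φ w₀ yF (pr.bOf du.1) →
      let a := S.aOf₁ G h e
      let a' := S.aOf₂ G h e
      let Q := faceStepWNb G pr φ P w₀ Λ b₀ (pr.bOf du.1) a' (tgt e) du j pc (aw du) Rlev N M L' (S.Sx G h e a a' du)
      ∀ j' ∈ Finset.Icc Q.j₀ Q.j₁, ∃ (σ : KNLevels.SData V) (Sz : Finset V),
        KNLevels.SHyp (winLData G (pr.frame φ w₀ du.1 (pr.bOf du.1)) Q.root Q.Rπ Q.lo Q.hi Q.root Q.Sfin) j' σ ∧ σ.N ≤ Q.N ∧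
        (1 - (S.p : ℝ) ^ σ.sB) ^ σ.k ≤ δ₂ ∧
        Sz ⊆ (winLData G (pr.frame φ w₀ du.1 (pr.bOf du.1)) Q.root Q.Rπ Q.lo Q.hi Q.root Q.Sfin).X j' ∧
        Sz ⊆ stepRg G (pr.frame φ w₀ du.1 (pr.bOf du.1)) Q ∧
        (∀ x ∈ σ.K, ∀ e' ∈ σ.seed x, e' ∉ wireSet (↑Sz : Set V)) ∧ (∀ x ∈ σ.K, σ.face x ⊆ Sz) ∧
        (∀ x ∈ σ.K, 1 - 3 * δ₂ ≤ (prodBernoulli (S.Wt G h e a a' du j o)).real {ω | ∃ u ∈ σ.face x,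
          1 - δ₂ < (prodBernoulli (pinW (S.Wt G h e a a' du j o) (wireSet (↑Sz : Set V)) ω)).real
            (⋃ t ∈ Q.T, openConnIn (↑(stepRg G (pr.frame φ w₀ du.1 (pr.bOf du.1)) Q) : Set V) u t)}) := by
  intro h e Λ S hrun hch hV du hdu j hj o yF pc hyF hpc a a' Q j' hj'
  -- the two maps and the frame facts
  have hL0' : pr.c₀ * pr.L 0 ≤ pr.D := by omega
  have hL1' : pr.c₁ * pr.L 1 ≤ pr.D := by omega
  have hlipψ : Lip G (pr.ψ φ w₀) := pr.lip_ψ hlipφ w₀ hc₀.le hc₁.le hD hL0' hL1'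
  have hws : WeakSteps G (pr.ψ φ w₀) := pr.weakSteps_ψ hstep w₀ hc₀.le hc₁.le hD
  have hψ0 : pr.ψ φ w₀ w₀ = 0 := pr.ψ_base φ w₀ hD
  have hcI : 0 < pr.cOf du.1 := pr.cOf_pos hc₀ hc₁ du.1
  have hLI : pr.cOf du.1 * pr.L du.1 ≤ pr.D := pr.cOf_mul_L_le hL0' hL1' du.1
  have hnz : pr.lvGen du.1 (pr.bOf du.1) ≠ 0 := pr.lvGen_bOf_ne_zero du.1 (pr.lvGen_ne_zero_of_detD_pos hDd hD du.1)
  have hb : |pr.lvGen du.1 (oth (pr.bOf du.1))| ≤ |pr.lvGen du.1 (pr.bOf du.1)| := pr.abs_lvGen_oth_bOf_le du.1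
  have hσ : sgOf du = 1 ∨ sgOf du = -1 := sgOf_sign du
  have hbpar : (b₀ du.1 : ℤ) + 2 ≤ 5 * P.r du.1 := by
    have h1 : (b₀ du.1 : ℤ) ≤ 3 * P.r du.1 := by exact_mod_cast hb₀ du.1
    have h2 : (1 : ℤ) ≤ P.r du.1 := by exact_mod_cast P.one_le_r du.1
    linarith
  have hbperp : (b₀ (oth du.1) : ℤ) + k₀ + 3 ≤ 5 * P.r (oth du.1) := by
    have h1 : (b₀ (oth du.1) : ℤ) ≤ 3 * P.r (oth du.1) := by exact_mod_cast hb₀ (oth du.1)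
    linarith [hk₀' (oth du.1)]
  -- the schedule and the realised radii
  have hΛW : WFS2 P Λ := concRadii2N_WFS2 P gap gap' E₀ L' off hgap hE₀ hL'
  have hr : Realised (S.aOf₁ G h e) (S.aOf₂ G h e) (tgt e) := realised_of_choice_SG₂b h hch
  have hy : tgt e + stepVec du ≠ 0 := tgt_add_stepVec_ne_zero₂b hψ0 hV hdu
  set g := nQ (S.aOf₁ G h e) (tgt e) with hg
  have hrM : Λ.rM a' (tgt e + stepVec du) = Erad gap gap' E₀ g + gap (Erad gap gap' E₀ g) - L' := by
    change Frad gap gap' E₀ (nQ (S.aOf₂ G h e) (tgt e + stepVec du)) - L' = _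
    rw [hr.nQ_add_stepVec hy, Frad_succ]
  have hrE : Λ.rE a' (tgt e) du = Erad gap gap' E₀ g + gap (Erad gap gap' E₀ g) - 1 := by
    have h1 : nQ (S.aOf₂ G h e) (tgt e + stepVec du) = nS (S.aOf₂ G h e) (tgt e) + 1 := by rw [hr.nQ_add_stepVec hy, hr.nS_eq]
    change (concRadii2N P gap gap' E₀ L' off).rE (S.aOf₂ G h e) (tgt e) du = _
    rw [concRadii2N_rE_eq P gap gap' E₀ L' off h1, hr.nS_eq, Frad_succ]
  have hgapg := hgapR (Erad gap gap' E₀ g)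
  have hR : PA.r₀ ≤ Λ.rE a' (tgt e) du := by rw [hrE]; omega
  have hrim : Λ.rM a' (tgt e + stepVec du) - L' + PA.r₀ ≤ Λ.rE a' (tgt e) du := by rw [hrM, hrE]; omega
  have hrE' : r ≤ Λ.rE a' (tgt e) du := le_trans (by omega) hR
  have hL'M : L' ≤ Λ.rM a' (tgt e + stepVec du) := by rw [hrM]; omega
  have hj'M : M + 1 ≤ j' := (Finset.mem_Icc.1 hj').1
  have hj'R : j' ≤ Rlev := (Finset.mem_Icc.1 hj').2
  have hRg : ∀ c', ∀ u ∈ RgO G φ QK c', u ∈ graphBall G c' Rs := fun c' u hu =>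
    graphBall_mono G c' (hRgRs c') (RgO_subset_graphBall QK c' u hu)
  -- the subbox fact, the law off the graph
  have hWD : KNLevels.IsSubbox (winGraph G Q.root Q.Rπ) (S.Wt G h e a a' du j o) S.p (stepRg G (pr.frame φ w₀ du.1 (pr.bOf du.1)) Q) :=
    isSubbox_faceStepWNb hΛW hb₀ hV hdu pc (aw du) Rlev N M L' hlipψ hws
  have hWG : ∀ e', e' ∉ G.edgeSet → S.Wt G h e a a' du j o e' = 0 := fun e' he => KNCells.KSchA.Wt_eq_zero_of_not_mem_edgeSet he
  -- the planar diameter of the step region (D2): `stepRg ⊆ Win ψ (farAS₂) ⊆ E^far`, whose `φ`-diameter is `m` by `hdiam`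
  have hAm := pr.A_mul_modulus_ne_zero hDd hD
  have hDm : ∀ d ∈ stepRg G (pr.frame φ w₀ du.1 (pr.bOf du.1)) Q, ∀ d' ∈ stepRg G (pr.frame φ w₀ du.1 (pr.bOf du.1)) Q, φ d - φ d' ∈ box 2 m := by
    intro d hd d' hd'
    have hSW := stepRgNb_subset_Win G pr φ P w₀ Λ b₀ (pr.bOf du.1) a' (tgt e) du j pc (aw du) Rlev N M L' (S.Sx G h e a a' du)
    have hEf := Win_farAS₂_subset_Efar_b P w₀ b₀ hlipψ hws (le_trans (by omega) (hΛW.ρE1 a' (tgt e) du 0)) j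
    exact hdiam_fine_b (a' := a') hAm hc₀ hc₁ hD hdiam (tgt e) du d (hEf (hSW hd)) d' (hEf (hSW hd'))
  -- the near reading on the face's axes, from the two lattice functionals (L-F2)
  have hI2 : du.1 = 0 ∨ du.1 = 1 := by rcases du with ⟨I, s⟩; fin_cases I <;> simp
  have hσh : σhF du = 1 ∨ σhF du = -1 := hσhF du
  have hnear₂' : ∀ c' w, |pr.vβ * (φ w 0 - φ c' 0) - pr.vα * (φ w 1 - φ c' 1)| ≤ Λ₀ → |(nL : ℤ) * (φ w 1 - φ c' 1) - pr.h * (φ w 0 - φ c' 0)| ≤ Λ₁ →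
      |fineSkel φ c' pr.A nL pr.h pr.vα pr.vβ pr.c₀ pr.c₁ (pr.D / 2) (pr.D / 2) pr.D w du.1| ≤ kA du.1 ∧
        |fineSkel φ c' pr.A nL pr.h pr.vα pr.vβ pr.c₀ pr.c₁ (pr.D / 2) (pr.D / 2) pr.D w (oth du.1)| ≤ kA (oth du.1) := fun c' w h0 h1 => by
    obtain ⟨k0, k1⟩ := abs_fineSkel_le_of_lam₂ (φ := φ) c' hD hc₀.le hc₁.le hkA0 hkA1 h0 h1
    rcases hI2 with hI | hI
    · rw [hI]; exact ⟨k0, k1⟩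
    · rw [hI]; exact ⟨k1, k0⟩
  -- the exit inequalities of the face table
  have hPex : ∀ (Lo Hi : Site 2) (i : Fin 2) (σ₀ : ℤˣ) (c' : V), ∀ v ∈ pr.pexFO G φ du.1 (pr.bOf du.1) QK C i σ₀ c', v ∈ RgO G φ QK c' ∧
      (pr.sideFormsU_frame φ w₀ du.1 (pr.bOf du.1) (pr.cOf_pos hc₀ hc₁ du.1) hA0.ne' hnz hD Lo Hi i σ₀).lin (φ v) + PA.A +
          pr.climC du.1 (pr.bOf du.1) i ≤
        (pr.sideFormsU_frame φ w₀ du.1 (pr.bOf du.1) (pr.cOf_pos hc₀ hc₁ du.1) hA0.ne' hnz hD Lo Hi i σ₀).lin (φ c') :=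
    fun Lo Hi i σ₀ c' v hv => ⟨pr.pexFO_subset φ du.1 (pr.bOf du.1) QK C i σ₀ c' hv,
      pr.hPex_pexFO φ w₀ du.1 (pr.bOf du.1) hcI hA0.ne' hnz hD hLI hA0 QK hn1 hEq hM4 hn2 hexitR (hexitL du.1) (hkC du.1) Lo Hi i σ₀ c' v hv⟩
  -- THE ROUTE at every centre, by the face's axis
  have hroute : ∀ c', pr.frame φ w₀ du.1 (pr.bOf du.1) c' ∈
        Finset.Icc (loN P (tgt e) du j pc (aw du) - ((E : ℕ) : Site 2)) (hiN P (tgt e) du j pc (aw du) + ((E : ℕ) : Site 2)) →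
      c' ∈ graphBall G w₀ (Λ.rE a' (tgt e) du - r) →
      ∃ Qt Ft : Finset V, Ft ⊆ Q.T ∧ Qt ⊆ stepRg G (pr.frame φ w₀ du.1 (pr.bOf du.1)) Q ∧ Disjoint Ft (Λc c' Mz) ∧
        1 - δ₂ ^ 2 < (prodBernoulli (S.Wt G h e a a' du j o)).real (linkIn (↑Qt : Set V) (Λc c' kz) Ft) := by
    rcases hI2 with hI | hI
    · exact hroute_of_faceRunNums_x6 hlipφ hstep hfr hκ hΔg pr w₀ du (pr.bOf du.1) hc₀ hc₁ hD hL0' hL1' hA0 hnz hnL hvL hmf P Λ b₀ a'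
        (tgt e) j pc (aw du) Rlev N M L' (S.Sx G h e a a' du) (hk₀ du.1) (by omega) hbpar hbperp hrE' hWG hWD hσ (B (sgOf du)) (hB _ hσ) hκL ℓ' R's qB Rl R'₃ qB₃
        hlay Rlev₁ N₁ j₀₁ j₁₁ Rlev₂ N₂ j₀₂ j₁₂ Rlev₃ N₃' j₀₃ j₁₃ (hRl₁ _ hσ) hRl₂ hRl₃ hj₁ hj₂ hj₃ (hB0 _ hσ) hRlr (hΛR _ hσ) hΛQ0 hΛQ1 hΛZ hnear₂' hkbMz
        (hπ1 _ hσ) (hclr₁ _ hσ) hδ hδ1 nF hchain hcount₁ hcount₂ hcount₃ hη Pb Pr hPNb hAb hd1b hD1b hD2b hDρb hℓb hWb hKmaxb hKCmaxb hR'b (hwideb _ hσ)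
        (hdwb _ hσ) (hDwb _ hσ) hTb hT'b hr₀b hRb₀ hrsb hcSb (hEb _ hσ) hreachb hr₁ hr₁R hPNr hAr hd1r hD1r hD2r hDρr hℓr hWr hKmaxr hKCmaxr hR'r hwider
        hdwr hDwr hwidey hdwy hDwy hTr hT'r hr₀r hRr₀ hrsr hcSr hEr hEy hreachr hr₂ hr₂R QK hRgRs hRgcard hcU1 hnSK hκSK hℓSK hκL10 Λc kz hkn hΛ
        hZ hMz hclrz hcz hzconn hRsr hZρ hρr hZU (Qb (sgOf du)) (Fb (sgOf du)) (hQb _ hσ) (hFb _ hσ) (hFZ _ hσ) kk₁ kk₂ kk₃ hkN₁ hkN₂ hkN₃ hk₁ hk₂ hk₃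
        hzone (hexitb _ hσ) (hexitr _ hσ) hexity (hbridge _ hσ) (hlongx _ hσ) hlongy hDm hR₁ hR₁b hR₁r
        (fun c' h1 h2 => numsX a' (tgt e) du j pc c' hI hj yF hyF hpc h1 h2 hL'M hrE') (fun c' h1 h2 => hnFx a' (tgt e) du j pc c' hI hj yF hyF hpc h1 h2 hL'M hrE')
    · exact hroute_of_faceRunNums_y6 hlipφ hstep hfr hκ hΔg pr w₀ du (pr.bOf du.1) hc₀ hc₁ hD hL0' hL1' hA0 hnz hnL hvL hmf P Λ b₀ a'
        (tgt e) j pc (aw du) Rlev N M L' (S.Sx G h e a a' du) (hk₀ du.1) (by omega) hbpar hbperp hrE' hWG hWD hσh hσ (B (σhF du)) (hB _ hσh) hκL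
        ℓ' R's qB Rl R'₃ qB₃ hlay Rlev₁ N₁ j₀₁ j₁₁ Rlev₂ N₂ j₀₂ j₁₂ Rlev₃ N₃' j₀₃ j₁₃ (hRl₁ _ hσh) hRl₂ hRl₃ hj₁ hj₂ hj₃ (hB0 _ hσh) hRlr (hΛR _ hσh) hΛQ0 hΛQ1
        hΛZ hnear₂' hkbMz (hπ1 _ hσh) (hclr₁ _ hσh) hδ hδ1 nF hchain hcount₁ hcount₂ hcount₃ hη Pb Pr hPNb hAb hd1b hD1b hD2b hDρb hℓb hWb hKmaxb hKCmaxb hR'b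
        (hwideb _ hσh) (hdwb _ hσh) (hDwb _ hσh) hTb hT'b hr₀b hRb₀ hrsb hcSb (hEb _ hσh) hreachb hr₁ hr₁R hPNr hAr hd1r hD1r hD2r hDρr hℓr hWr hKmaxr hKCmaxr hR'r
        hwiderY hdwrY hDwrY hwideyY hdwyY hDwyY hTr hT'r hr₀r hRr₀ hrsr hcSr hEr hEy hreachr hr₂ hr₂R QK hRgRs hRgcard hcU1 hnSK hκSK hℓSK hκL10 Λc
        kz hkn hΛ hZ hMz hclrz hcz hzconn hRsr hZρ hρr hZU (Qb (σhF du)) (Fb (σhF du)) (hQb _ hσh) (hFb _ hσh) (hFZ _ hσh) kk₁ kk₂ kk₃ hkN₁ hkN₂ hkN₃ hk₁ hk₂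
        hk₃ hzone (hexitb _ hσh) hexitr (hexity _ hσ) (hbridge _ hσh) hlongx (hlongy _ hσ) hDm hR₁ hR₁b hR₁r
        (fun c' h1 h2 => numsY a' (tgt e) du j pc c' hI hj yF hyF hpc h1 h2 hL'M hrE') (fun c' h1 h2 => hnFy a' (tgt e) du j pc c' hI hj yF hyF hpc h1 h2 hL'M hrE')
  -- assemble
  exact hkits_faceStepWNbG hlipφ hstep hfr hκ hΔg hδ₂ pr w₀ du (pr.bOf du.1) hc₀ hc₁ hD hL0' hL1' hA0 hb hnz (hnC du.1) (hU3 du.1) P Λ b₀ a'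
    (tgt e) j pc (aw du) Rlev N M L' (S.Sx G h e a a' du) hyF hpc (by omega) (hRlev du.1) (hRlev' (oth du.1)) (hroomF du) (hkF du.1) hj'M
    hj'R PA hPN hA hd1 hD1 hD2 hDρ hℓ hW hKmax hKCmax hR' hMtan hMd hMD hT hT' hr₀ hR hrs hcS hE hreach hrim (RgO G φ QK) hRg hRgcard hcU1 Λc
    kz hkn hΛ (pr.pexFO G φ du.1 (pr.bOf du.1) QK C) hPex kk hWD hN hk hzoneK (hexitK du.1) hroute

end Skelφ

end Summit.CriticalPhenomena.PercolationContinuityZ3.Theorems.Transplant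

end
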